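import Literature.AlgebraicGeometry.Resolution.LocalBlowup
import Mathlib.FieldTheory.Minpoly.Field
import Mathlib.RingTheory.LocalRing.ResidueField.Basic
import Mathlib.RingTheory.Adjoin.Polynomial.Basic
import Mathlib.RingTheory.Polynomial.Tower
import Mathlib.Algebra.Polynomial.Lifts
import HarnessLib

/-!
# The centre of a valuation on a monoidal transform: "`(y_{i₃}, y_{i₁}, P(y_{i₂}/y_{i₁}))` is a r.s.p." ([CoP1] §8)

Topic: `Literature/AlgebraicGeometry/Resolution`. PROOF side of `CossartPiltant2019ReductionP`
(`ArithmeticalThreefoldsLocal.lean`), input (C4): the head of the decomposition layer of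
[CoP1] Prop. 9.3 is [CoP1] Prop. 8.1 (`DecompositionLayerStrictParameters.lean`), whose proof
(HAL pp. 22–24) runs on MONOIDAL TRANSFORMS along the valuation:

> Let `S₂⁽¹⁾` be the monoidal transform at `(y_{i₁}, y_{i₂})` of `S₂` along `W`. If
> `W y_{i₂} ≥ W y_{i₁}`, then `(y_{i₃}, y_{i₁}, P(y_{i₂}/y_{i₁}))` is a r.s.p. of `S₂⁽¹⁾`, where
> `P ∈ S₂[X]` is monic and such that its image in `κ(S₂)[X]` is irreducible. … If
> `W y_{i₂} < W y_{i₁}`, `(y_{i₃}, y_{i₁}/y_{i₂}, y_{i₂})` is a r.s.p. (HAL p. 23)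

This file PROVES the generation statement behind this sentence, for a local subring `R ⊆ O`
of a field `K` dominated by the valuation ring `O` with residue field of `O` algebraic over
that of `R`, elements `x_c` generating `𝔪_R`, and `z = x_b/x_a ∈ O`: there is a monic
`P ∈ R[X]` lifting the minimal polynomial of the residue of `z` such that every element of
`R[z]` of positive value lies in the ideal `(x_c : c ≠ b) + (P(z))` of `R[z]`
(`exists_monic_forall_mem_span_monoidal`); when `v(z) > 0` one may take the generators
`(x_c : c ≠ b), z` (as `P(z) ≡ z` modulo `(x_c)_c`). Hence the maximal ideal of
the local ring `locAtCentre R[z] O` is generated by these elements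
(`exists_monic_maximalIdeal_locAtCentre_monoidal`). Regularity of the transform is
`MonoidalTransformRegular.lean`.

Everything is PROVED; no named facts, definitions, instances or notation are introduced.

## Sources

* V. Cossart, O. Piltant, J. Algebra 320 (2008) 1051–1082: proof of Prop. 8.1 (HAL
  hal-00139124, p. 23). [CossartPiltant2008]
-/

noncomputable section

namespace Literature.AlgebraicGeometry.Resolution

universe u

open IsLocalRing Polynomial

variable {K : Type u} [Field K]

section Centre

variable (R : Subring K) [IsLocalRing R] (O : ValuationSubring K)

/-- The inclusion of a dominated local subring into the valuation ring is a local
homomorphism. [folklore] -/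
private theorem isLocalHom_inclusion (hRO : R ≤ O.toSubring)
    (hdom : ∀ r : R, r ∈ maximalIdeal R → O.valuation (r : K) < 1) :
    IsLocalHom (Subring.inclusion hRO) := by
  refine ⟨fun r hr => ?_⟩
  by_contra hnu
  have hlt := hdom r ((IsLocalRing.mem_maximalIdeal _).mpr hnu)
  obtain ⟨u, hu⟩ := hr
  have h1 : O.valuation ((Subring.inclusion hRO r : O) : K) = 1 := by
    rw [← hu]
    exact (O.valuation_eq_one_iff _).mp u.isUnit
  exact (lt_irrefl _) (h1 ▸ hlt)

set_option maxHeartbeats 800000 in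
/-- **The centre of `O` on `R[z]`, `z = x_b/x_a`** ([CoP1] proof of Prop. 8.1, HAL p. 23:
"`(y_{i₃}, y_{i₁}, P(y_{i₂}/y_{i₁}))` is a r.s.p. of `S₂⁽¹⁾`, where `P ∈ S₂[X]` is monic and
such that its image in `κ(S₂)[X]` is irreducible"). Let `R ⊆ O` be a local subring dominated
by `O` whose residue field makes that of `O` algebraic (`halg`), `(x_c)_c` generators of `𝔪_R`,
`a ≠ b` with `v(x_b) ≥ v(x_a)` (i.e. `z := x_b/x_a ∈ O`). Then there is a monic `P ∈ R[X]`
with `v(P(z)) > 0` such that every element of `R[z]` of positive value lies in the ideal of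
`R[z]` generated by the `x_c`, `c ≠ b`, and `P(z)`.
[cite: CossartPiltant2008, proof of Prop. 8.1 (HAL p. 23)] -/
theorem exists_monic_forall_mem_span_monoidal (hRO : R ≤ O.toSubring)
    (hdom : ∀ r : R, r ∈ maximalIdeal R → O.valuation (r : K) < 1)
    (halg : ∀ y : O, ∃ q : R[X], (∃ k, q.coeff k ∉ maximalIdeal R) ∧
      O.valuation (aeval (y : K) q) < 1)
    {ι : Type*} (x : ι → R) (hx : Ideal.span (Set.range x) = maximalIdeal R)
    (a b : ι) (hab : a ≠ b) (hxa : (x a : K) ≠ 0)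
    (hle : O.valuation (x b : K) ≤ O.valuation (x a : K)) :
    ∃ P : R[X], P.Monic ∧ O.valuation (aeval ((x b : K) / (x a : K)) P) < 1 ∧
      ∀ w : Algebra.adjoin R {(x b : K) / (x a : K)}, O.valuation (w : K) < 1 →
        w ∈ Ideal.span (Set.range (fun c : {c // c ≠ b} =>
            algebraMap R (Algebra.adjoin R {(x b : K) / (x a : K)}) (x c)) ∪
          {aeval (⟨(x b : K) / (x a : K), Algebra.self_mem_adjoin_singleton R _⟩ :
            Algebra.adjoin R {(x b : K) / (x a : K)}) P}) := by
  classical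
  set z : K := (x b : K) / (x a : K) with hzdef
  set B : Subalgebra R K := Algebra.adjoin R {z} with hBdef
  let zB : B := ⟨z, Algebra.self_mem_adjoin_singleton R z⟩
  have hzO : z ∈ O := by
    rw [← O.valuation_le_one_iff, hzdef, map_div₀]
    exact div_le_one_of_le₀ hle zero_le
  -- residue fields
  let φ : R →+* O := Subring.inclusion hRO
  haveI : IsLocalHom φ := isLocalHom_inclusion R O hRO hdom
  let κ := ResidueField R
  let κO := ResidueField O
  let ψ : κ →+* κO := ResidueField.map φ
  letI : Algebra κ κO := ψ.toAlgebra
  let zO : O := ⟨z, hzO⟩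
  let zbar : κO := residue O zO
  -- evaluation compatibilities
  have hevalK : ∀ q : R[X], ((q.eval₂ φ zO : O) : K) = aeval z q := by
    intro q
    rw [aeval_def]
    exact Polynomial.hom_eval₂ q φ O.subtype zO
  have hcomp : (residue O).comp φ = (algebraMap κ κO).comp (residue R) := by
    ext r
    exact (ResidueField.map_residue φ r).symm
  have hevalRes : ∀ q : R[X], residue O (q.eval₂ φ zO) = aeval zbar (q.map (residue R)) := by
    intro q
    simp only [hom_eval₂, aeval_def, eval₂_map, hcomp]
    rfl
  have hval_lt : ∀ q : R[X], O.valuation (aeval z q) < 1 ↔ aeval zbar (q.map (residue R)) = 0 := by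
    intro q
    rw [← hevalRes, residue_eq_zero_iff, ValuationSubring.valuation_lt_one_iff, hevalK]
  -- `zbar` is algebraic over `κ`
  have hzint : IsIntegral κ zbar := by
    obtain ⟨q, ⟨k, hk⟩, hq⟩ := halg zO
    have hq0 : q.map (residue R) ≠ 0 := by
      intro h
      apply hk
      have := congrArg (fun p => p.coeff k) h
      rw [coeff_map, coeff_zero] at this
      exact (residue_eq_zero_iff _).mp this
    exact (isAlgebraic_iff_isIntegral.mp ⟨q.map (residue R), hq0, (hval_lt q).mp hq⟩)
  -- lift the minimal polynomial
  have hlifts : minpoly κ zbar ∈ Polynomial.lifts (residue R) :=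
    (mem_lifts _).mpr (map_surjective _ residue_surjective _)
  obtain ⟨P, hPmap, -, hPmon⟩ := lifts_and_natDegree_eq_and_monic hlifts (minpoly.monic hzint)
  have hPz : O.valuation (aeval z P) < 1 := by
    rw [hval_lt, hPmap]
    exact minpoly.aeval κ zbar
  refine ⟨P, hPmon, hPz, fun w hw => ?_⟩
  -- `w = q(z)`
  obtain ⟨q, hq⟩ : ∃ q : R[X], aeval zB q = w := by
    have h : (w : K) ∈ (aeval (R := R) z).range := by
      rw [← Algebra.adjoin_singleton_eq_range_aeval]
      exact w.2
    obtain ⟨q, hq⟩ := h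
    exact ⟨q, Subtype.ext (by rw [← Subalgebra.aeval_coe]; exact hq)⟩
  -- `q̄ = P̄ h̄`
  have hqbar : aeval zbar (q.map (residue R)) = 0 := by
    rw [← hval_lt]
    have : (aeval z q) = (w : K) := by
      rw [← hq, ← Subalgebra.aeval_coe]
    rw [this]
    exact hw
  obtain ⟨hbar, hh⟩ := minpoly.dvd κ zbar hqbar
  obtain ⟨h, hhmap⟩ := map_surjective (residue R) residue_surjective hbar
  -- `m := q - P h` has coefficients in `𝔪_R`
  set m : R[X] := q - P * h with hmdef
  have hmcoeff : ∀ k, m.coeff k ∈ maximalIdeal R := by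
    intro k
    rw [← residue_eq_zero_iff, ← coeff_map]
    have : m.map (residue R) = 0 := by
      rw [hmdef, Polynomial.map_sub, Polynomial.map_mul, hPmap, hhmap, hh, sub_self]
    rw [this, coeff_zero]
  -- the ideal `J = (x_c : c ≠ b) + (P(z))` of `B`
  set J : Ideal B := Ideal.span (Set.range (fun c : {c // c ≠ b} => algebraMap R B (x c)) ∪
    {aeval zB P}) with hJdef
  have hxcJ : ∀ c, algebraMap R B (x c) ∈ J := by
    intro c
    by_cases hcb : c = b
    · -- `x_b = z · x_a ∈ (x_a)`
      subst hcb
      have hxa' : algebraMap R B (x c) = zB * algebraMap R B (x a) := by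
        apply Subtype.ext
        change ((x c : R) : K) = z * ((x a : R) : K)
        rw [hzdef, div_mul_cancel₀ _ hxa]
      rw [hxa']
      exact Ideal.mul_mem_left _ _ (Ideal.subset_span (Or.inl ⟨⟨a, hab⟩, rfl⟩))
    · exact Ideal.subset_span (Or.inl ⟨⟨c, hcb⟩, rfl⟩)
  have hmJ : ∀ r ∈ maximalIdeal R, algebraMap R B r ∈ J := by
    intro r hr
    rw [← hx] at hr
    refine Submodule.span_induction (p := fun r _ => algebraMap R B r ∈ J) ?_ ?_ ?_ ?_ hr
    · rintro _ ⟨c, rfl⟩; exact hxcJ c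
    · rw [map_zero]; exact J.zero_mem
    · intro r s _ _ hr hs; rw [map_add]; exact J.add_mem hr hs
    · intro t r _ hr; rw [smul_eq_mul, map_mul]; exact J.mul_mem_left _ hr
  have hmz : aeval zB m ∈ J := by
    rw [aeval_eq_sum_range]
    refine J.sum_mem fun k _ => ?_
    rw [Algebra.smul_def]
    exact J.mul_mem_right _ (hmJ _ (hmcoeff k))
  -- conclusion
  have hqJ : aeval zB q = aeval zB P * aeval zB h + aeval zB m := by
    rw [hmdef, map_sub, map_mul]; ring
  rw [← hq, hqJ]
  exact J.add_mem (J.mul_mem_right _ (Ideal.subset_span (Or.inr rfl))) hmz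

/-- **The maximal ideal of the monoidal transform along `O`** (the local ring
`R₁ = locAtCentre R[z] O`, `z = x_b/x_a`): it is generated by the `x_c`, `c ≠ b`, and `P(z)`
for a monic `P ∈ R[X]` with `v(P(z)) > 0` ([CoP1] HAL p. 23: "`(y_{i₃}, y_{i₁},
P(y_{i₂}/y_{i₁}))` is a r.s.p. of `S₂⁽¹⁾`"; when `v(z) > 0`, `P(z) ≡ z` modulo `(x_c)_c`).
[cite: CossartPiltant2008, proof of Prop. 8.1 (HAL p. 23)] -/
theorem exists_monic_maximalIdeal_locAtCentre_monoidal (hRO : R ≤ O.toSubring)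
    (hdom : ∀ r : R, r ∈ maximalIdeal R → O.valuation (r : K) < 1)
    (halg : ∀ y : O, ∃ q : R[X], (∃ k, q.coeff k ∉ maximalIdeal R) ∧
      O.valuation (aeval (y : K) q) < 1)
    {ι : Type*} (x : ι → R) (hx : Ideal.span (Set.range x) = maximalIdeal R)
    (a b : ι) (hab : a ≠ b) (hxa : (x a : K) ≠ 0)
    (hle : O.valuation (x b : K) ≤ O.valuation (x a : K))
    (hBO : (Algebra.adjoin R {(x b : K) / (x a : K)}).toSubring ≤ O.toSubring) :
    ∃ P : R[X], P.Monic ∧ O.valuation (aeval ((x b : K) / (x a : K)) P) < 1 ∧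
      (haveI := isLocalRing_locAtCentre hBO
       maximalIdeal (locAtCentre (Algebra.adjoin R {(x b : K) / (x a : K)}).toSubring O) =
         Ideal.span (Set.range (fun c : {c // c ≠ b} =>
             (⟨(x c : K), le_locAtCentre _ _
               ((Algebra.adjoin R {(x b : K) / (x a : K)}).algebraMap_mem (x c))⟩ :
               locAtCentre (Algebra.adjoin R {(x b : K) / (x a : K)}).toSubring O)) ∪
           {⟨aeval ((x b : K) / (x a : K)) P, le_locAtCentre _ _
               (Polynomial.aeval_mem_adjoin_singleton R _)⟩})) := by
  classical
  set z : K := (x b : K) / (x a : K) with hzdef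
  set B : Subalgebra R K := Algebra.adjoin R {z} with hBdef
  haveI hloc := isLocalRing_locAtCentre hBO
  obtain ⟨P, hPmon, hPz, hspan⟩ :=
    exists_monic_forall_mem_span_monoidal R O hRO hdom halg x hx a b hab hxa hle
  refine ⟨P, hPmon, hPz, ?_⟩
  -- the inclusion `B → R₁`
  let ιB : B →+* locAtCentre B.toSubring O :=
    (B.val : B →+* K).codRestrict (locAtCentre B.toSubring O) (fun w => le_locAtCentre _ _ w.2)
  have hιB : ∀ w : B, ((ιB w : locAtCentre B.toSubring O) : K) = (w : K) := fun _ => rfl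
  refine le_antisymm ?_ ?_
  · intro y hy
    have hvy : O.valuation (y : K) < 1 := (mem_maximalIdeal_locAtCentre_iff hBO y).mp hy
    obtain ⟨w, hw, s, hs, hvs, hyws⟩ := y.2
    have hs0 : s ≠ 0 := ne_zero_of_valuation_eq_one hvs
    have hvw : O.valuation w < 1 := by
      have : w = (y : K) * s := by rw [hyws, div_mul_cancel₀ _ hs0]
      rw [this, map_mul, hvs, mul_one]
      exact hvy
    have hwJ := hspan ⟨w, hw⟩ hvw
    -- transport along `ιB`
    have hmap := Ideal.mem_map_of_mem ιB hwJ
    rw [Ideal.map_span] at hmap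
    have hsinv : s⁻¹ ∈ locAtCentre B.toSubring O :=
      inv_mem_locAtCentre (le_locAtCentre _ _ hs) hvs
    have hy_eq : y = ιB ⟨w, hw⟩ * ⟨s⁻¹, hsinv⟩ := by
      apply Subtype.ext
      change (y : K) = w * s⁻¹
      rw [hyws, div_eq_mul_inv]
    rw [hy_eq]
    refine Ideal.mul_mem_right _ _ (Ideal.span_mono ?_ hmap)
    rintro _ ⟨g, hg, rfl⟩
    rcases hg with ⟨c, rfl⟩ | hg
    · exact Or.inl ⟨c, Subtype.ext rfl⟩
    · rw [Set.mem_singleton_iff] at hg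
      subst hg
      refine Or.inr ?_
      rw [Set.mem_singleton_iff]
      apply Subtype.ext
      rw [hιB]
      exact (Subalgebra.aeval_coe B _ P).symm
  · refine Ideal.span_le.mpr ?_
    rintro _ (⟨c, rfl⟩ | h)
    · rw [SetLike.mem_coe, mem_maximalIdeal_locAtCentre_iff hBO]
      exact hdom (x c) (hx ▸ Ideal.subset_span ⟨(c : ι), rfl⟩)
    · rw [Set.mem_singleton_iff] at h
      subst h
      rw [SetLike.mem_coe, mem_maximalIdeal_locAtCentre_iff hBO]
      exact hPz

end Centre

/-- If `x, y` lie in a valuation ring and `x * y = 1` then `v(x) = 1` (a private copy of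
`valuation_eq_one_of_mul_eq_one`, `AffineModelLU.lean`, to keep imports light). [folklore] -/
private theorem valuation_eq_one_of_mul_eq_one' (O : ValuationSubring K)
    {x y : K} (hx : x ∈ O) (hy : y ∈ O) (hxy : x * y = 1) : O.valuation x = 1 := by
  have hx1 := (O.valuation_le_one_iff x).mpr hx
  have hy1 := (O.valuation_le_one_iff y).mpr hy
  refine le_antisymm hx1 ?_
  have h : O.valuation x * O.valuation y = 1 := by rw [← map_mul, hxy, map_one]
  by_contra hlt
  have : O.valuation x * O.valuation y < 1 * 1 :=
    mul_lt_mul_of_lt_of_le_of_nonneg_of_pos (lt_of_not_ge hlt) hy1 zero_le zero_lt_one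
  rw [h, one_mul] at this
  exact lt_irrefl _ this

section PositiveValue

variable (R : Subring K) [IsLocalRing R] (O : ValuationSubring K)

set_option maxHeartbeats 800000 in
/-- **The case `W y_{i₂} > W y_{i₁}` / "`W y_{i₂} < W y_{i₁}`" of [CoP1] HAL p. 23**: if
`z = x_b/x_a` has POSITIVE value, the maximal ideal of the monoidal transform
`locAtCentre R[z] O` is generated by the `x_c`, `c ≠ b`, and `z` itself ("`(y_{i₃}, y_{i₁},
y_{i₂}/y_{i₁})`", resp. "`(y_{i₃}, y_{i₁}/y_{i₂}, y_{i₂})`" is a r.s.p.): the monic `P` of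
`exists_monic_maximalIdeal_locAtCentre_monoidal` has constant term in `𝔪_R`.
[cite: CossartPiltant2008, proof of Prop. 8.1 (HAL p. 23)] -/
theorem maximalIdeal_locAtCentre_monoidal_of_valuation_lt_one (hRO : R ≤ O.toSubring)
    (hdom : ∀ r : R, r ∈ maximalIdeal R → O.valuation (r : K) < 1)
    (halg : ∀ y : O, ∃ q : R[X], (∃ k, q.coeff k ∉ maximalIdeal R) ∧
      O.valuation (aeval (y : K) q) < 1)
    {ι : Type*} (x : ι → R) (hx : Ideal.span (Set.range x) = maximalIdeal R)
    (a b : ι) (hab : a ≠ b) (hxa : (x a : K) ≠ 0)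
    (hlt : O.valuation ((x b : K) / (x a : K)) < 1)
    (hBO : (Algebra.adjoin R {(x b : K) / (x a : K)}).toSubring ≤ O.toSubring) :
    haveI := isLocalRing_locAtCentre hBO
    maximalIdeal (locAtCentre (Algebra.adjoin R {(x b : K) / (x a : K)}).toSubring O) =
      Ideal.span (Set.range (fun c : {c // c ≠ b} =>
          (⟨(x c : K), le_locAtCentre _ _
            ((Algebra.adjoin R {(x b : K) / (x a : K)}).algebraMap_mem (x c))⟩ :
            locAtCentre (Algebra.adjoin R {(x b : K) / (x a : K)}).toSubring O)) ∪
        {⟨(x b : K) / (x a : K), le_locAtCentre _ _ (Algebra.self_mem_adjoin_singleton R _)⟩}) := by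
  classical
  haveI hloc := isLocalRing_locAtCentre hBO
  have hle : O.valuation (x b : K) ≤ O.valuation (x a : K) := by
    have heq : (x b : K) = (x b : K) / (x a : K) * (x a : K) := by
      rw [div_mul_cancel₀ _ hxa]
    rw [heq, map_mul]
    exact mul_le_of_le_one_left zero_le hlt.le
  obtain ⟨P, hPmon, hPz, hmax⟩ := exists_monic_maximalIdeal_locAtCentre_monoidal R O hRO hdom
    halg x hx a b hab hxa hle hBO
  set z : K := (x b : K) / (x a : K) with hzdef
  set B : Subalgebra R K := Algebra.adjoin R {z} with hBdef
  set R₁ : Subring K := locAtCentre B.toSubring O with hR₁def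
  have hzB : z ∈ B := Algebra.self_mem_adjoin_singleton R z
  let zR : R₁ := ⟨z, le_locAtCentre _ _ hzB⟩
  let xR : ι → R₁ := fun c => ⟨(x c : K), le_locAtCentre _ _ (B.algebraMap_mem (x c))⟩
  -- the target ideal `J = (x_c : c ≠ b) + (z)` contains every `x_c`
  set J : Ideal R₁ := Ideal.span (Set.range (fun c : {c // c ≠ b} => xR c) ∪ {zR}) with hJdef
  have hxJ : ∀ c, xR c ∈ J := by
    intro c
    by_cases hcb : c = b
    · subst hcb
      have : xR c = zR * xR a := by
        apply Subtype.ext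
        change ((x c : R) : K) = z * ((x a : R) : K)
        rw [hzdef, div_mul_cancel₀ _ hxa]
      rw [this]
      exact Ideal.mul_mem_left _ _ (Ideal.subset_span (Or.inl ⟨⟨a, hab⟩, rfl⟩))
    · exact Ideal.subset_span (Or.inl ⟨⟨c, hcb⟩, rfl⟩)
  have hmJ : ∀ r : R, r ∈ maximalIdeal R →
      (⟨(r : K), le_locAtCentre _ _ (B.algebraMap_mem r)⟩ : R₁) ∈ J := by
    intro r hr
    rw [← hx] at hr
    refine Submodule.span_induction
      (p := fun (r : R) _ => (⟨((r : R) : K), le_locAtCentre _ _ (B.algebraMap_mem r)⟩ : R₁) ∈ J)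
      ?_ ?_ ?_ ?_ hr
    · rintro _ ⟨c, rfl⟩; exact hxJ c
    · have : (⟨((0 : R) : K), le_locAtCentre _ _ (B.algebraMap_mem 0)⟩ : R₁) = 0 :=
        Subtype.ext (by simp)
      rw [this]; exact J.zero_mem
    · intro r s _ _ hr hs
      have : (⟨((r + s : R) : K), le_locAtCentre _ _ (B.algebraMap_mem (r + s))⟩ : R₁) =
          ⟨(r : K), le_locAtCentre _ _ (B.algebraMap_mem r)⟩ +
            ⟨(s : K), le_locAtCentre _ _ (B.algebraMap_mem s)⟩ := Subtype.ext (by simp)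
      rw [this]; exact J.add_mem hr hs
    · intro t r _ hr
      have : (⟨((t • r : R) : K), le_locAtCentre _ _ (B.algebraMap_mem (t • r))⟩ : R₁) =
          ⟨(t : K), le_locAtCentre _ _ (B.algebraMap_mem t)⟩ *
            ⟨(r : K), le_locAtCentre _ _ (B.algebraMap_mem r)⟩ := Subtype.ext (by simp)
      rw [this]; exact J.mul_mem_left _ hr
  -- `P(z) = z · Q(z) + P(0)` with `P(0) ∈ 𝔪_R`
  have hPz' : (⟨aeval z P, le_locAtCentre _ _ (Polynomial.aeval_mem_adjoin_singleton R _)⟩ : R₁)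
      ∈ J := by
    have hdecomp : aeval z P = z * aeval z P.divX + ((P.coeff 0 : R) : K) := by
      conv_lhs => rw [← P.X_mul_divX_add]
      rw [map_add, map_mul, aeval_X, aeval_C]
      rfl
    -- `v(P(0)) < 1`, hence `P(0) ∈ 𝔪_R`
    have hQO : aeval z P.divX ∈ O := hBO (Polynomial.aeval_mem_adjoin_singleton R _)
    have hc0 : (P.coeff 0 : R) ∈ maximalIdeal R := by
      by_contra hnot
      have hu : IsUnit (P.coeff 0) := by
        by_contra hnu; exact hnot ((IsLocalRing.mem_maximalIdeal _).mpr hnu)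
      obtain ⟨c, hc⟩ := hu.exists_right_inv
      have h1 : O.valuation (((P.coeff 0 : R)) : K) = 1 :=
        valuation_eq_one_of_mul_eq_one' O (hRO (P.coeff 0).2) (hRO c.2)
          (by rw [← Subring.coe_mul, hc, Subring.coe_one])
      have hlt' : O.valuation (((P.coeff 0 : R)) : K) < 1 := by
        have heq : (((P.coeff 0 : R)) : K) = aeval z P - z * aeval z P.divX := by
          rw [hdecomp]; ring
        rw [heq]
        refine lt_of_le_of_lt (Valuation.map_sub _ _ _) (max_lt hPz ?_)
        rw [map_mul]
        calc O.valuation z * O.valuation (aeval z P.divX)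
            ≤ O.valuation z * 1 := by
              gcongr
              exact (O.valuation_le_one_iff _).mpr hQO
          _ < 1 := by rw [mul_one]; exact hlt
      exact (lt_irrefl _) (h1 ▸ hlt')
    have hQR : (⟨aeval z P.divX, le_locAtCentre _ _
        (Polynomial.aeval_mem_adjoin_singleton R _)⟩ : R₁) ∈ (⊤ : Ideal R₁) := Submodule.mem_top
    have heq : (⟨aeval z P, le_locAtCentre _ _ (Polynomial.aeval_mem_adjoin_singleton R _)⟩ : R₁)
        = zR * ⟨aeval z P.divX, le_locAtCentre _ _ (Polynomial.aeval_mem_adjoin_singleton R _)⟩ +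
          ⟨((P.coeff 0 : R) : K), le_locAtCentre _ _ (B.algebraMap_mem _)⟩ :=
      Subtype.ext hdecomp
    rw [heq]
    exact J.add_mem (J.mul_mem_right _ (Ideal.subset_span (Or.inr rfl))) (hmJ _ hc0)
  refine le_antisymm ?_ ?_
  · rw [hmax]
    refine Ideal.span_le.mpr ?_
    rintro _ (⟨c, rfl⟩ | h)
    · exact Ideal.subset_span (Or.inl ⟨c, rfl⟩)
    · rw [Set.mem_singleton_iff] at h
      subst h
      exact hPz'
  · refine Ideal.span_le.mpr ?_
    rintro _ (⟨c, rfl⟩ | h)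
    · rw [SetLike.mem_coe, mem_maximalIdeal_locAtCentre_iff hBO]
      exact hdom (x c) (hx ▸ Ideal.subset_span ⟨(c : ι), rfl⟩)
    · rw [Set.mem_singleton_iff] at h
      subst h
      rw [SetLike.mem_coe, mem_maximalIdeal_locAtCentre_iff hBO]
      exact hlt

end PositiveValue

end Literature.AlgebraicGeometry.Resolution

end
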